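import Summits.AtomisticToContinuum.Crystallization.Theses.ChessboardParticlePlanes

/-!
# Crux `PeriodicWindows` (stmt-AtomisticToContinuum-3240), line `Sketch` — input glue G0

Helper for the lead skeleton `PeriodicWindowsSketch` (rev 5, route `ChessboardParticlePlanes`): the rev-4 input
stub `stub_laminarWindowsGeom` (laminar, `7/10`-separated, `ρ₀`-dense windows of every size, frequently in `N`, up
to a linear isometry) is DERIVED by pure counting from the three density-zero inputs of the skeleton, which are
board items / shared stubs verbatim: a.e. laminarity (item stmt-AtomisticToContinuum-14293
`LaminarSixThreeThree.LjLaminarity`), separation density at `7/10` (stub S2 of line `Sketch` of crux 6711), no foam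
(item stmt-AtomisticToContinuum-13453 `SurfaceTensionNoFoam.NoFoam`). For fixed `η > 0` and `L ≥ 1`, eventually in
`N` each bad fraction is `< 1/3`, so one particle is good in all three senses; its levels give the isometry and the
height set (`laminar_of_levels`, adapted from the lead skeleton of crux 6711), and no-foam at radius `L` gives
`r₀`-density on the ball of radius `L - r₀` (`ρ₀ = r₀`, the no-foam radius).
-/

noncomputable section

namespace Summit.AtomisticToContinuum.Crystallization.Theorems.PeriodicWindowsSketch

open Literature.MathematicalPhysics.StatisticalMechanics Filter Metric

/-! ## Glue G0 (proved): density-zero inputs ⇒ laminar, separated, dense windows -/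

/-- Levels with consecutive gaps `≥ 3/4` are `3/4`-separated: `c k + 3/4·(m+1) ≤ c (k + (m+1))`.
(adapted from the lead skeleton of crux 6711, `Cruxes/LjLaminarWindows/Lines/Sketch.lean`) -/
private theorem levels_gap (c : ℤ → ℝ) (hc : ∀ k : ℤ, c k + 3 / 4 ≤ c (k + 1)) (k : ℤ) (m : ℕ) :
    c k + 3 / 4 * (m + 1 : ℝ) ≤ c (k + (m + 1 : ℕ)) := by
  induction m with
  | zero => simpa using hc k
  | succ m ih =>
    have h := hc (k + (m + 1 : ℕ))
    have e : k + ((m + 1 + 1 : ℕ) : ℤ) = k + ((m + 1 : ℕ) : ℤ) + 1 := by push_cast; ring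
    rw [e]
    push_cast at ih h ⊢
    linarith

/-- The range of such levels is a `3/4`-separated set.
(adapted from the lead skeleton of crux 6711, `Cruxes/LjLaminarWindows/Lines/Sketch.lean`) -/
private theorem levels_separated (c : ℤ → ℝ) (hc : ∀ k : ℤ, c k + 3 / 4 ≤ c (k + 1)) :
    ∀ s ∈ Set.range c, ∀ s' ∈ Set.range c, s ≠ s' → (3 : ℝ) / 4 ≤ |s - s'| := by
  rintro _ ⟨k, rfl⟩ _ ⟨k', rfl⟩ hne
  have key : ∀ k k' : ℤ, k < k' → (3 : ℝ) / 4 ≤ c k' - c k := by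
    intro k k' hlt
    obtain ⟨m, hm⟩ : ∃ m : ℕ, k' = k + (m + 1 : ℕ) := by
      refine ⟨(k' - k - 1).toNat, ?_⟩
      have : 0 ≤ k' - k - 1 := by omega
      push_cast
      rw [Int.toNat_of_nonneg this]
      ring
    have h := levels_gap c hc k m
    rw [← hm] at h
    have : (0 : ℝ) ≤ m := Nat.cast_nonneg m
    nlinarith
  rcases lt_trichotomy k k' with h | h | h
  · have := key k k' h
    rw [abs_sub_comm, abs_of_nonneg (by linarith)]
    exact this
  · exact absurd (congrArg c h) hne
  · have := key k' k h
    rw [abs_of_nonneg (by linarith)]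
    exact this

/-- **Levels ⇒ isometry.** A unit normal `n` and levels `c` (gaps `≥ 3/4`) controlling the window of
`i` give a linear isometry `A` (coordinates in an orthonormal basis with third vector `n`, so that
`(A v)₂ = ⟪v, n⟫`) and the `3/4`-separated height set `T = range c` of the laminarity clause.
(adapted from the lead skeleton of crux 6711, `Cruxes/LjLaminarWindows/Lines/Sketch.lean`) -/
private theorem laminar_of_levels {N : ℕ} (y : Fin N → EuclideanSpace ℝ (Fin 3)) (i : Fin N)
    (R t : ℝ) (n : EuclideanSpace ℝ (Fin 3)) (hn : ‖n‖ = 1)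
    (c : ℤ → ℝ) (hc : ∀ k : ℤ, c k + 3 / 4 ≤ c (k + 1))
    (h : ∀ j : Fin N, dist (y j) (y i) ≤ R → ∃ k : ℤ, |inner ℝ (y j - y i) n - c k| ≤ t) :
    ∃ (A : EuclideanSpace ℝ (Fin 3) →ₗᵢ[ℝ] EuclideanSpace ℝ (Fin 3)) (T : Set ℝ),
      (∀ s ∈ T, ∀ s' ∈ T, s ≠ s' → (3 : ℝ) / 4 ≤ |s - s'|) ∧
      ∀ j : Fin N, dist (y j) (y i) ≤ R → ∃ s ∈ T, |(A (y j - y i)) 2 - s| ≤ t := by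
  have hon : Orthonormal ℝ (({(2 : Fin 3)} : Set (Fin 3)).restrict fun _ : Fin 3 => n) := by
    refine ⟨fun _ => by simpa using hn, ?_⟩
    intro a b hab
    exact absurd (Subsingleton.elim a b) hab
  obtain ⟨b, hb⟩ := Orthonormal.exists_orthonormalBasis_extension_of_card_eq
    (𝕜 := ℝ) (E := EuclideanSpace ℝ (Fin 3)) (ι := Fin 3) (by simp) hon
  have hb2 : b 2 = n := hb 2 (by simp)
  refine ⟨b.repr.toLinearIsometry, Set.range c, levels_separated c hc, fun j hj => ?_⟩
  obtain ⟨k, hk⟩ := h j hj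
  refine ⟨c k, ⟨k, rfl⟩, ?_⟩
  have : (b.repr.toLinearIsometry (y j - y i)) 2 = inner ℝ (y j - y i) n := by
    show b.repr (y j - y i) 2 = inner ℝ (y j - y i) n
    rw [b.repr_apply_apply, hb2, real_inner_comm]
  rw [this]
  exact hk

/-- Counting: a subtype of `Fin N` cut out by `P` has `Nat.card` equal to the card of the filter. -/
private theorem natCard_subtype_eq_card_filter {N : ℕ} (P : Fin N → Prop) [DecidablePred P] :
    Nat.card {i : Fin N // P i} = (Finset.univ.filter P).card := by
  rw [Nat.card_eq_fintype_card, Fintype.card_subtype]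

/-- **G0 (proved): the rev-4 input stub `stub_laminarWindowsGeom` from the three density-zero
inputs.** For fixed `η > 0` and `L ≥ 1`, eventually in `N` the three bad fractions (non-laminar at
thickness `η` and radius `L`; a pair closer than `7/10` in the `L`-ball; an `r₀`-vacuum point within
`L`) are each `< 1/3`, so some particle `i` is good in all three senses; its levels give the isometry
`A` and the height set `T` (`laminar_of_levels`), and no-foam at radius `L` gives `r₀`-density on
the ball of radius `L - r₀`. -/
theorem laminarWindowsGeom_of
    (hlam : ∀ t R : ℝ, 0 < t → 0 < R → ∀ x : (N : ℕ) → (Fin N → EuclideanSpace ℝ (Fin 3)),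
      (∀ N, IsGroundState lennardJones (x N)) →
      Filter.Tendsto (fun N : ℕ => (Nat.card {i : Fin N // ¬ (∃ n : EuclideanSpace ℝ (Fin 3),
        ‖n‖ = 1 ∧ ∃ c : ℤ → ℝ, (∀ k : ℤ, c k + 3 / 4 ≤ c (k + 1)) ∧ ∀ j : Fin N,
          dist (x N j) (x N i) ≤ R → ∃ k : ℤ, |inner ℝ (x N j - x N i) n - c k| ≤ t)} : ℝ) / N)
        Filter.atTop (nhds 0))
    (hsep : ∀ R : ℝ, 0 < R → ∀ x : (N : ℕ) → (Fin N → EuclideanSpace ℝ (Fin 3)),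
      (∀ N, IsGroundState lennardJones (x N)) →
      Filter.Tendsto (fun N : ℕ => (Nat.card {i : Fin N // ∃ j k : Fin N, j ≠ k ∧
        dist (x N j) (x N i) ≤ R ∧ dist (x N k) (x N i) ≤ R ∧ dist (x N j) (x N k) < 7 / 10} : ℝ) / N)
        Filter.atTop (nhds 0))
    (hfoam : ∃ r₀ : ℝ, 0 < r₀ ∧ ∀ R : ℝ, 0 < R → ∀ x : (N : ℕ) → (Fin N → EuclideanSpace ℝ (Fin 3)),
      (∀ N, IsGroundState lennardJones (x N)) →
      Filter.Tendsto (fun N : ℕ => (Nat.card {i : Fin N // ∃ c : EuclideanSpace ℝ (Fin 3),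
        dist c (x N i) ≤ R ∧ ∀ j : Fin N, r₀ ≤ dist c (x N j)} : ℝ) / N) Filter.atTop (nhds 0)) :
    ∃ ρ₀ : ℝ, 0 < ρ₀ ∧ ∀ x : (N : ℕ) → (Fin N → EuclideanSpace ℝ (Fin 3)),
      (∀ N, IsGroundState lennardJones (x N)) → ∀ η : ℝ, 0 < η →
      ∃ L₀ : ℝ, ∀ L : ℝ, L₀ ≤ L → ∃ᶠ N in Filter.atTop,
        ∃ (i : Fin N) (A : EuclideanSpace ℝ (Fin 3) →ₗᵢ[ℝ] EuclideanSpace ℝ (Fin 3)) (T : Set ℝ),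
          (∀ t ∈ T, ∀ t' ∈ T, t ≠ t' → (3 : ℝ) / 4 ≤ |t - t'|) ∧
          (∀ j k : Fin N, j ≠ k → dist (x N j) (x N i) ≤ L → dist (x N k) (x N i) ≤ L →
            (7 : ℝ) / 10 ≤ dist (x N j) (x N k)) ∧
          (∀ j : Fin N, dist (x N j) (x N i) ≤ L → ∃ t ∈ T, |(A (x N j - x N i)) 2 - t| ≤ η) ∧
          (∀ c : EuclideanSpace ℝ (Fin 3), dist c (x N i) ≤ L - ρ₀ →
            ∃ j : Fin N, dist (x N j) c ≤ ρ₀) := by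
  classical
  obtain ⟨r₀, hr₀, hfoam⟩ := hfoam
  refine ⟨r₀, hr₀, fun x hx η hη => ⟨1, fun L hL => ?_⟩⟩
  have hLpos : 0 < L := by linarith
  -- the three bad predicates at this scale
  set Plam : (N : ℕ) → Fin N → Prop := fun N i => ¬ (∃ n : EuclideanSpace ℝ (Fin 3),
      ‖n‖ = 1 ∧ ∃ c : ℤ → ℝ, (∀ k : ℤ, c k + 3 / 4 ≤ c (k + 1)) ∧ ∀ j : Fin N,
        dist (x N j) (x N i) ≤ L → ∃ k : ℤ, |inner ℝ (x N j - x N i) n - c k| ≤ η) with hPlam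
  set Psep : (N : ℕ) → Fin N → Prop := fun N i => ∃ j k : Fin N, j ≠ k ∧
      dist (x N j) (x N i) ≤ L ∧ dist (x N k) (x N i) ≤ L ∧ dist (x N j) (x N k) < 7 / 10 with hPsep
  set Pfoam : (N : ℕ) → Fin N → Prop := fun N i => ∃ c : EuclideanSpace ℝ (Fin 3),
      dist c (x N i) ≤ L ∧ ∀ j : Fin N, r₀ ≤ dist c (x N j) with hPfoam
  have h1 : ∀ᶠ N : ℕ in atTop, (Nat.card {i : Fin N // Plam N i} : ℝ) / N < 1 / 3 :=
    (hlam η L hη hLpos x hx).eventually_lt_const (by norm_num)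
  have h2 : ∀ᶠ N : ℕ in atTop, (Nat.card {i : Fin N // Psep N i} : ℝ) / N < 1 / 3 :=
    (hsep L hLpos x hx).eventually_lt_const (by norm_num)
  have h3 : ∀ᶠ N : ℕ in atTop, (Nat.card {i : Fin N // Pfoam N i} : ℝ) / N < 1 / 3 :=
    (hfoam L hLpos x hx).eventually_lt_const (by norm_num)
  refine Filter.Eventually.frequently ?_
  filter_upwards [h1, h2, h3, Filter.eventually_ge_atTop 1] with N hN1 hN2 hN3 hN
  have hNpos : (0 : ℝ) < N := by exact_mod_cast hN
  -- counting: the union of the three bad sets misses a particle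
  rw [natCard_subtype_eq_card_filter, div_lt_iff₀ hNpos] at hN1 hN2 hN3
  set B : Finset (Fin N) := (Finset.univ.filter (Plam N)) ∪ (Finset.univ.filter (Psep N)) ∪
    (Finset.univ.filter (Pfoam N)) with hB
  have hBcard : (B.card : ℝ) < N := by
    have hu := Finset.card_union_le ((Finset.univ.filter (Plam N)) ∪ (Finset.univ.filter (Psep N)))
      (Finset.univ.filter (Pfoam N))
    have hu' := Finset.card_union_le (Finset.univ.filter (Plam N)) (Finset.univ.filter (Psep N))
    have : (B.card : ℝ) ≤ (Finset.univ.filter (Plam N)).card + (Finset.univ.filter (Psep N)).card +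
        (Finset.univ.filter (Pfoam N)).card := by
      rw [hB]; exact_mod_cast hu.trans (by omega)
    linarith
  have hBne : B ≠ Finset.univ := by
    intro hBU
    rw [hBU, Finset.card_univ, Fintype.card_fin] at hBcard
    exact lt_irrefl _ hBcard
  obtain ⟨i, -, hiB⟩ : ∃ i ∈ (Finset.univ : Finset (Fin N)), i ∉ B := by
    by_contra hcon
    push Not at hcon
    exact hBne (Finset.eq_univ_of_forall fun i => hcon i (Finset.mem_univ i))
  simp only [hB, Finset.mem_union, Finset.mem_filter, Finset.mem_univ, true_and, not_or] at hiB
  obtain ⟨⟨hgl, hgs⟩, hgf⟩ := hiB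
  -- laminarity of the good particle
  rw [hPlam] at hgl
  push Not at hgl
  obtain ⟨n, hn, c, hc, hlev⟩ := hgl
  obtain ⟨A, T, hT, hAT⟩ := laminar_of_levels (x N) i L η n hn c hc hlev
  refine ⟨i, A, T, hT, ?_, hAT, ?_⟩
  · -- separation in the window
    intro j k hjk hj hk
    by_contra hlt
    rw [not_le] at hlt
    exact hgs ⟨j, k, hjk, hj, hk, hlt⟩
  · -- density from no-foam at radius `L`
    intro c' hc'
    by_contra hno
    push Not at hno
    refine hgf ⟨c', hc'.trans (by linarith), fun j => ?_⟩
    have := hno j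
    rw [dist_comm] at this
    exact this.le

end Summit.AtomisticToContinuum.Crystallization.Theorems.PeriodicWindowsSketch

end
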